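import Summits.ResolutionOfSingularities.ResolutionOfSingularities.Theorems.RadicialJungCleanModelsKbarRationalOfCossart1987
import Summits.ResolutionOfSingularities.ResolutionOfSingularities.Theorems.CossartPiltant2019PrincipalizationHolds
import Literature.AlgebraicGeometry.Morphisms.NagataCompactificationProofs
import Literature.AlgebraicGeometry.Resolution.ArithmeticalThreefoldsBlowupFormDimThree
import Literature.AlgebraicGeometry.CossartPiltant200819.Thm21VerbatimBlowupProjective2008
import Literature.AlgebraicGeometry.Resolution.RegularBlowup
import Literature.AlgebraicGeometry.Resolution.BlowupsProduct
import Literature.AlgebraicGeometry.Resolution.BlowupsIntegral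
import Literature.AlgebraicGeometry.Resolution.CofinalityFromPrincipalization
import Literature.AlgebraicGeometry.Resolution.QuasiExcellentSchemes
import Literature.AlgebraicGeometry.Resolution.ExcellentRingsFieldProofs
import Literature.AlgebraicGeometry.Resolution.ResolutionGlue
import HarnessLib

/-!
# Route `RadicialJung`, crux `CleanModels` (stmt-15917): regular QUASI-PROJECTIVE models of regular threefolds over any field
# (Chow ✓ + Stacks 081T ✓ + Cossart–Piltant principalization ✓), and the `k = k̄` slice of the crux for EVERY `W` from
# Cossart's normal form for a rational function ALONE

Explicit-unit seat `decomp-res-hand-1` g23 (share: the printed stubs 1–4 of `Cruxes/CleanModels/Lines/Sketch.lean` rev 35).  OURS,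
def-free, counted 0.  Nothing here proves resolution of singularities in characteristic `p`; the one printed theorem that enters the
clean-model corollaries does so as a NAMED-FACT HYPOTHESIS (✓-typed `Literature.AlgebraicGeometry.Resolution.Cossart1987ThmRational`,
Cossart 1987 as globalised by Posva 2024, Claim 5.1.2 / App. A §A.7).

WHAT IS NEW.  The predecessor file `…KbarRationalOfCossart1987.lean` (g22) derives the crux on {`k = k̄`, `dim W = 3`, EVERY separated
`W` of finite type} from TWO printed theorems: Cossart/Posva (`Cossart1987ThmRational`, stated for QUASI-PROJECTIVE regular threefolds) and
Cossart–Piltant 2008 Thm. 2.1 (`CP2008.ResolutionQuasiProjectiveThreefolds`), the latter only to replace an arbitrary `W` by a regular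
quasi-projective model (Chow's lemma yields a possibly SINGULAR quasi-projective model, which was then resolved by CP 2008).  Here the second
printed theorem is REMOVED: a regular `W` needs no resolution of its Chow model.  By Chow (✓ `ChowLemmaIntegral_holds`) there is a proper
`π₁ : X₁ → W`, an isomorphism over a dense open `U`, with `X₁` quasi-projective; by Stacks 081T with 080E (✓ `Morphisms.exists_isBlowup_dominating`,
unconditional in the tree) the `U`-admissible blowing up `b : S' = Bl_𝓘 W → W` dominates `X₁` through a blowing up `r : S' → X₁`, so `S'` is
quasi-projective (✓ `CP2008.isQuasiProjectiveOver_comp_of_isBlowup`, Hartshorne II 7.16 (c)); Cossart–Piltant's principalization of `𝓘` on the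
regular excellent threefold `W` (✓ `CP2008Prop44.CossartPiltant2019Principalization_holds`, PROVED in the tree from [CoP1] Prop. 4.4) is a
sequence `σ : W̃ → W` of blowing ups in regular centres — one blowing up in some `𝓚` (✓ `IsRegularCentreBlowupSeq.exists_isBlowup_supported`,
Stacks 080B), `W̃` regular, `𝓘𝒪_{W̃}` invertible — hence the blowing up of `W` in `𝓚 · 𝓘` (Stacks 080A); so is `Bl_{𝓚𝒪_{S'}} S' → S' → W`
(✓ `IsBlowup.comp`), whence `W̃ ≅ Bl_{𝓚𝒪_{S'}} S'` is QUASI-PROJECTIVE.  This is Cossart–Piltant's own Step 3 of the proof of [CP 2019]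
Prop. 4.6 («achieving (i) with `π` projective»), run on a regular `W` (the tree runs it on CP's Thm. 1.1 in
`ArithmeticalThreefoldsBlowupFormDimThree.lean`, modulo Raynaud–Gruson; here nothing printed is needed).  Hence:

  **every regular integral separated threefold of finite type over ANY field has a proper birational regular model which is
  quasi-projective over the field** (`exists_quasiProjective_regular_model_dimThree`), and

  **on {`k` algebraically closed, `dim W ≤ 3`} the crux `CleanModels` follows from ONE PRINTED THEOREM (Cossart 1987 / Posva 2024
  Claim 5.1.2) and kernel theorems** (`cleanModelsAt_dimThree_algClosed_of_cossartRational`, `…dimLEThree…`,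
  `cleanModels_algClosed_dimLEThree_of_cossartRational` = the crux's binders verbatim + `IsAlgClosed k` + `dim W ≤ 3`).

References: Posva 2024 (arXiv:2405.05735) Claim 5.1.2, App. A §A.7 [Posva2024]; Cossart 1987 [Cossart1987]; Cossart–Piltant 2019 Prop. 4.4
and the proof of Prop. 4.6, Step 3 [CossartPiltant2019]; The Stacks Project Tags 081T, 080E, 080A, 080B [StacksProject]; Hartshorne II
Prop. 7.16 (c) [Hartshorne1977]; Görtz–Wedhorn I Thm. 13.100 [GortzWedhorn2020].
-/

noncomputable section

set_option linter.dupNamespace false -- mandated namespace of this single-conjunct summit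

open IsLocalRing
open Literature.AlgebraicGeometry.Resolution
open Summit.ResolutionOfSingularities.ResolutionOfSingularities.Theorems.RadicialJung.CleanModels
open CategoryTheory AlgebraicGeometry TopologicalSpace
open Literature.AlgebraicGeometry.CossartPiltant200819.CP2008
open Literature.AlgebraicGeometry.Motives

namespace Summit.ResolutionOfSingularities.ResolutionOfSingularities.Theorems.RadicialJung.CleanModels.KbarQuasiProjective

universe u

/-- **A regular threefold over a field has a regular QUASI-PROJECTIVE proper birational model.**  For every field `k` and every regular
integral `W`, separated and of finite type over `k` with `dim W = 3`, there are a regular integral `W̃`, quasi-projective over `k`, and a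
proper birational `σ : W̃ → W` (indeed a blowing up of `W`), `dim W̃ = 3`.  Proof: Chow (✓ `ChowLemmaIntegral_holds`) → Stacks 081T/080E
(✓ `Morphisms.exists_isBlowup_dominating`: `b : S' = Bl_𝓘 W → W` dominating the quasi-projective Chow model through a blowing up, so `S'` is
quasi-projective, ✓ `isQuasiProjectiveOver_comp_of_isBlowup`) → Cossart–Piltant principalization of `𝓘` on `W` (✓ PROVED
`CossartPiltant2019Principalization_holds`): `σ : W̃ → W`, one blowing up in `𝓚` with `𝓘𝒪_{W̃}` invertible, hence the blowing up in `𝓚 · 𝓘`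
(Stacks 080A/080B), as is `Bl_{𝓚𝒪_{S'}} S' → S' → W`; uniqueness of blowing ups gives `W̃ ≅ Bl_{𝓚𝒪_{S'}} S'`, quasi-projective.
[cite: CossartPiltant2019, Prop. 4.4 and proof of Prop. 4.6 (Step 3)] [cite: StacksProject, Tag 081T; Tag 080A; Tag 080B]
[cite: Hartshorne1977, II Prop. 7.16 (c)] [cite: GortzWedhorn2020, Thm 13.100] -/
theorem exists_quasiProjective_regular_model_dimThree
    (k : Type u) [Field k] (W : Scheme.{u}) [IsIntegral W] (f : W ⟶ Spec (.of k))
    [IsSeparated f] [LocallyOfFiniteType f] [QuasiCompact f]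
    (hW : Scheme.IsRegular W) (hdim : topologicalKrullDim W = 3) :
    ∃ (W' : Scheme.{u}) (σ : W' ⟶ W) (_ : IsIntegral W'),
      IsProper σ ∧ IsBirational σ ∧ Scheme.IsRegular W' ∧ IsQuasiProjectiveOver (σ ≫ f) ∧
      topologicalKrullDim W' = 3 := by
  classical
  haveI : CompactSpace W := QuasiCompact.compactSpace_of_compactSpace f
  haveI : IsLocallyNoetherian W := LocallyOfFiniteType.isLocallyNoetherian f
  haveI : IsNoetherian W := {}
  haveI : QuasiSeparatedSpace W := quasiSeparatedSpace_of_quasiSeparated f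
  /- (1) Chow: `W ← X₁ ↪ ℙⁿ`, an isomorphism over the dense open `U₀` -/
  obtain ⟨n, X₁, π₁, ι, hX₁int, hι, hπ₁prop, -, hcomm, U₀, hU₀, -, hiso₀⟩ :=
    ChowLemmaIntegral_holds k W f inferInstance inferInstance inferInstance inferInstance
  haveI := hX₁int
  haveI := hπ₁prop
  haveI := hiso₀
  let f₁ : X₁ ⟶ Spec (.of k) := π₁ ≫ f
  have hqp₁ : IsQuasiProjectiveOver f₁ := ⟨n, ι, hι, hcomm⟩
  have hU₀ne : (U₀ : Set W).Nonempty := hU₀.nonempty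
  /- (2) Stacks 081T with 080E: the `U₀`-admissible blowing up `b : S' → W` of `𝓘` dominating `X₁` through the blowing up
  `r : S' → X₁` of `𝓘𝒪_{X₁}`; `S'` is quasi-projective over `k` -/
  obtain ⟨I, S', b, r, -, hIsupp, hb, hrπ, hr⟩ :=
    Literature.AlgebraicGeometry.Morphisms.exists_isBlowup_dominating π₁ U₀ (NoetherianSpace.isCompact _)
  have hI : I ≠ ⊥ := by
    intro h0
    obtain ⟨x, hx⟩ := hU₀ne
    have hmem : x ∈ (I.support : Set W) := by rw [h0, Scheme.IdealSheafData.support_bot]; trivial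
    rw [hIsupp] at hmem
    exact hmem hx
  have hqpS' : IsQuasiProjectiveOver (b ≫ f) := by
    have h := (isQuasiProjectiveOver_comp_of_isBlowup hqp₁ hr).1
    have e : r ≫ f₁ = b ≫ f := by rw [← Category.assoc, hrπ]
    rwa [e] at h
  /- (3) Cossart–Piltant principalization of `𝓘` on the regular excellent threefold `W` -/
  have hexc : Scheme.IsExcellent W := Scheme.isExcellent_of_locallyOfFiniteType Stacks07QW_field_holds f
  obtain ⟨W', σ, hseq, hprinc⟩ :=
    Summit.ResolutionOfSingularities.ResolutionOfSingularities.Theorems.CP2008Prop44.CossartPiltant2019Principalization_holds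
      W hW hexc hdim I hI
  haveI : IsIntegral W' := hseq.isIntegral hI
  have hW'reg : Scheme.IsRegular W' := hseq.isRegular hW
  have hres : IsResolution σ := hseq.isResolution hI hW
  haveI : IsProper σ := hres.isProper
  have hcart : IsEffectiveCartier (I.comap σ) :=
    hprinc.isEffectiveCartier_of_ne_bot (hseq.isIntegral_and_comap_ne_bot inferInstance inferInstance hI).2.2
  -- `σ` is one blowing up in `𝓚`, and also the blowing up in `𝓚 · 𝓘`
  obtain ⟨K, hK, -⟩ := hseq.exists_isBlowup_supported inferInstance
  have hσ : IsBlowup σ (K * I) := by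
    have := hK.comp (IsBlowup.id hcart)
    rwa [Category.id_comp] at this
  /- (4) the blowing up `t : T → S'` of `𝓚𝒪_{S'}`; `t ≫ b` is the blowing up of `W` in `𝓘 · 𝓚`, so `W' ≅ T` -/
  obtain ⟨T, t, ht⟩ := exists_isBlowup S' (K.comap b)
  have htb : IsBlowup (t ≫ b) (K * I) := by
    rw [mul_comm]
    exact hb.comp ht
  have hqpT : IsQuasiProjectiveOver ((t ≫ b) ≫ f) := by
    have h := (isQuasiProjectiveOver_comp_of_isBlowup hqpS' ht).1
    rwa [← Category.assoc] at h
  obtain ⟨e, he, -⟩ := hσ.unique htb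
  -- transport quasi-projectivity along `e : W' ≅ T` (over `W`)
  have hqpW' : IsQuasiProjectiveOver (σ ≫ f) := by
    obtain ⟨m, j, hj, hjcomm⟩ := hqpT
    haveI := hj
    refine ⟨m, e.hom ≫ j, inferInstance, ?_⟩
    rw [Category.assoc, hjcomm, ← he]
    simp only [Category.assoc]
  -- dimension through the common open over which `σ` is an isomorphism
  have hdim' : topologicalKrullDim W' = 3 := by
    obtain ⟨U, hU, -, hisoU⟩ := hres.isBirational
    haveI := hisoU
    haveI : LocallyOfFiniteType σ := inferInstance
    exact (topologicalKrullDim_eq_of_isIso_morphismRestrict f σ U hU.nonempty).trans hdim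
  exact ⟨W', σ, inferInstance, hres.isProper, hres.isBirational, hW'reg, hqpW', hdim'⟩

/-- **`CleanModels` for ALL regular threefolds over `k̄` (separated, of finite type), from Cossart/Posva ALONE.**
`exists_quasiProjective_regular_model_dimThree` replaces `W` by a regular QUASI-PROJECTIVE proper birational model `W̃` (Chow + Stacks 081T +
Cossart–Piltant principalization, all kernel); then `hCR` (Cossart 1987 / Posva 2024 Claim 5.1.2, typed `Cossart1987ThmRational`) on `W̃` for
the radicand read in `K(W̃)`, and the packaging ✓ `KbarRational.cleanModelsAt_of_nuZeroAt_closedPoints` for the composite `V → W̃ → W`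
(representatives transported along `(π₃ ≫ σ)^♯ = π₃^♯ ∘ σ^♯`, ✓ `RatFn.functionFieldMap_comp`).  Compared with
✓ `KbarRational.cleanModelsAt_dimThree_algClosed_of_cossartRational_of_cp2008` the hypothesis `CP2008.ResolutionQuasiProjectiveThreefolds`
(Cossart–Piltant 2008 Thm. 2.1) is GONE (and `W` is assumed regular, as in the crux).
[cite: Posva2024, Claim 5.1.2 and App. A §A.7] [cite: Cossart1987, main theorem] [cite: CossartPiltant2019, Prop. 4.4]
[cite: StacksProject, Tag 081T] [cite: GortzWedhorn2020, Thm 13.100] -/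
theorem cleanModelsAt_dimThree_algClosed_of_cossartRational
    (hCR : Cossart1987ThmRational)
    (p : ℕ) (hp : p.Prime) (k : Type) [Field k] [CharP k p] [IsAlgClosed k]
    (W : Scheme.{0}) [IsIntegral W] (f : W ⟶ Spec (.of k)) [IsSeparated f] [LocallyOfFiniteType f]
    [QuasiCompact f] (hW : Scheme.IsRegular W) (hdim : topologicalKrullDim W = 3)
    (L : Type) [Field L] [Algebra W.functionField L]
    [IsPurelyInseparable W.functionField L] (hdeg : Module.finrank W.functionField L = p) :
    ∃ (V : Scheme.{0}) (π : V ⟶ W) (_ : IsIntegral V) (_ : IsDominant π),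
      IsProper π ∧ IsBirational π ∧ Scheme.IsRegular V ∧
      (∀ v : V, (∃ (y : L) (g : W.functionField), y ∉ Set.range (algebraMap W.functionField L) ∧
        algebraMap W.functionField L g = y ^ p ∧
        ((∃ (d m : ℕ) (hmd : m ≤ d) (t : Fin d → V.presheaf.stalk v) (a : Fin m → ℕ),
            Ideal.span (Set.range t) = maximalIdeal (V.presheaf.stalk v) ∧
            ringKrullDim (V.presheaf.stalk v) = (d : WithBot ℕ∞) ∧ 0 < m ∧ (∀ i, ¬ p ∣ a i) ∧
            RatFn.functionFieldMap π g = ∏ i : Fin m,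
              (algebraMap (V.presheaf.stalk v) V.functionField (t (Fin.castLE hmd i))) ^ (a i)) ∨
          (∃ u₀ : V.presheaf.stalk v, IsUnit u₀ ∧
            RatFn.functionFieldMap π g = algebraMap (V.presheaf.stalk v) V.functionField u₀ ∧
            ((∀ c : V.presheaf.stalk v, u₀ - c ^ p ∉ maximalIdeal (V.presheaf.stalk v)) ∨
              (∃ c : V.presheaf.stalk v, u₀ - c ^ p ∈ maximalIdeal (V.presheaf.stalk v) ∧
                u₀ - c ^ p ∉ maximalIdeal (V.presheaf.stalk v) ^ 2)))))) := by
  classical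
  haveI : Fact p.Prime := ⟨hp⟩
  haveI : CharP W.functionField p := charP_stalk W f _
  obtain ⟨-, y₀, g₀, hy₀, hg₀, hg₀p⟩ := stub_generator (K := W.functionField) (L := L) p hp hdeg
  /- (1)–(2) a regular quasi-projective proper birational model `σ : X₂ → W` -/
  obtain ⟨X₂, σ, hX₂int, hσprop, hbir₂, hX₂reg, hqp₂, hdim₂⟩ :=
    exists_quasiProjective_regular_model_dimThree k W f hW hdim
  haveI := hX₂int
  haveI := hσprop
  haveI : IsDominant σ := hbir₂.isDominant
  let f₂ : X₂ ⟶ Spec (.of k) := σ ≫ f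
  obtain ⟨hlft₂, hsep₂, hqc₂⟩ := hqp₂.finiteType_isSeparated_quasiCompact
  haveI := hlft₂; haveI := hsep₂; haveI := hqc₂
  haveI : CompactSpace X₂ := QuasiCompact.compactSpace_of_compactSpace f₂
  /- the radicand upstairs -/
  have hbij₂ : Function.Bijective (RatFn.functionFieldMap σ) := by
    obtain ⟨U', hU', hU'', hiso⟩ := hbir₂
    haveI := hiso
    exact RatFn.functionFieldMap_bijective_of_isIso_morphismRestrict σ U' hU' hU''
  let u₂ : X₂.functionField := RatFn.functionFieldMap σ g₀
  have hu₂ : ∀ c : X₂.functionField, c ^ p ≠ u₂ := by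
    intro c hc
    obtain ⟨c', rfl⟩ := hbij₂.2 c
    exact hg₀p c' (hbij₂.1 (by rw [map_pow]; exact hc))
  /- (3) Cossart/Posva on `X₂` -/
  obtain ⟨V, π₃, hVint, hdom₃, hπ₃, hVreg, ⟨U₂, hU₂ne, hiso₂⟩, hν⟩ := hCR p k X₂ f₂ hqp₂ hX₂reg hdim₂ u₂ hu₂
  haveI := hVint
  haveI := hdom₃
  haveI := hπ₃
  haveI := hiso₂
  obtain ⟨hbir₃, -⟩ := Lens5.KbarCossart.isBirational_and_denseRange π₃ U₂ hU₂ne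
  /- (4) the composite `V → W` and the transported representatives -/
  let π : V ⟶ W := π₃ ≫ σ
  have hbir : IsBirational π := hbir₃.comp hbir₂
  haveI hdom : IsDominant π := hbir.isDominant
  haveI : IsProper π := inferInstance
  have hcomp : ∀ z : W.functionField,
      RatFn.functionFieldMap π z = RatFn.functionFieldMap π₃ (RatFn.functionFieldMap σ z) := fun z =>
    RingHom.congr_fun (RatFn.functionFieldMap_comp σ π₃) z
  have hν' : ∀ x : V, IsClosed ({x} : Set V) → ∃ (v : W.functionField) (g : V.presheaf.stalk x), v ≠ 0 ∧
      algebraMap (V.presheaf.stalk x) V.functionField g = RatFn.functionFieldMap π (g₀ * v ^ p) ∧ NuZeroAt g := by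
    intro x _
    obtain ⟨v₂, g, hv₂, hg, hN⟩ := hν x
    obtain ⟨v, rfl⟩ := hbij₂.2 v₂
    refine ⟨v, g, fun h0 => hv₂ (by rw [h0, map_zero]), ?_, hN⟩
    rw [hg, hcomp]
    simp only [map_mul, map_pow, u₂]
  exact ⟨V, π, hVint, hdom, inferInstance, hbir, hVreg, fun x =>
    KbarRational.cleanModelsAt_of_nuZeroAt_closedPoints p hp k W f L y₀ g₀ hy₀ hg₀ V π hbir hVreg hν' x⟩

/-- **`CleanModels` on {`k` algebraically closed, `dim W ≤ 3`} from ONE printed theorem** (dimension `≤ 2` is unconditional in the tree —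
F-75c ✓ `stub_stacks0BICLocus` through ✓ `cleanModels_dimLETwo_of_f75c`; dimension `3` is `cleanModelsAt_dimThree_algClosed_of_cossartRational`).
[cite: Posva2024, Claim 5.1.2 and App. A §A.7] [cite: StacksProject, Tag 0BIC] -/
theorem cleanModelsAt_dimLEThree_algClosed_of_cossartRational
    (hCR : Cossart1987ThmRational)
    (p : ℕ) (hp : p.Prime) (k : Type) [Field k] [CharP k p] [IsAlgClosed k]
    (W : Scheme.{0}) [IsIntegral W] (f : W ⟶ Spec (.of k)) [IsSeparated f] [LocallyOfFiniteType f]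
    [QuasiCompact f] (hW : Scheme.IsRegular W) (hdim : topologicalKrullDim W ≤ 3)
    (L : Type) [Field L] [Algebra W.functionField L]
    [IsPurelyInseparable W.functionField L] (hdeg : Module.finrank W.functionField L = p) :
    ∃ (V : Scheme.{0}) (π : V ⟶ W) (_ : IsIntegral V) (_ : IsDominant π),
      IsProper π ∧ IsBirational π ∧ Scheme.IsRegular V ∧
      (∀ v : V, (∃ (y : L) (g : W.functionField), y ∉ Set.range (algebraMap W.functionField L) ∧
        algebraMap W.functionField L g = y ^ p ∧
        ((∃ (d m : ℕ) (hmd : m ≤ d) (t : Fin d → V.presheaf.stalk v) (a : Fin m → ℕ),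
            Ideal.span (Set.range t) = maximalIdeal (V.presheaf.stalk v) ∧
            ringKrullDim (V.presheaf.stalk v) = (d : WithBot ℕ∞) ∧ 0 < m ∧ (∀ i, ¬ p ∣ a i) ∧
            RatFn.functionFieldMap π g = ∏ i : Fin m,
              (algebraMap (V.presheaf.stalk v) V.functionField (t (Fin.castLE hmd i))) ^ (a i)) ∨
          (∃ u₀ : V.presheaf.stalk v, IsUnit u₀ ∧
            RatFn.functionFieldMap π g = algebraMap (V.presheaf.stalk v) V.functionField u₀ ∧
            ((∀ c : V.presheaf.stalk v, u₀ - c ^ p ∉ maximalIdeal (V.presheaf.stalk v)) ∨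
              (∃ c : V.presheaf.stalk v, u₀ - c ^ p ∈ maximalIdeal (V.presheaf.stalk v) ∧
                u₀ - c ^ p ∉ maximalIdeal (V.presheaf.stalk v) ^ 2)))))) := by
  rcases le_two_or_eq_three_of_le_three hdim with h2 | h3
  · exact cleanModels_dimLETwo_of_f75c stub_stacks0BICLocus p hp k W f hW L hdeg h2
  · exact cleanModelsAt_dimThree_algClosed_of_cossartRational hCR p hp k W f hW h3 L hdeg

/-- **The `k = k̄` branch of the crux in the SKELETON'S OWN BINDER SHAPE, from ONE printed theorem**: the conclusion of
`Theses.RadicialJung.CleanModels` for `(p, k, W, f, L)` with the crux's binders VERBATIM, under the two extra hypotheses `IsAlgClosed k` and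
`topologicalKrullDim W ≤ 3`, from `Cossart1987ThmRational` (Cossart 1987 / Posva 2024 Claim 5.1.2) ALONE — the one-`exact` target of a
`by_cases IsAlgClosed k` in the dim-`≤ 3` slice of a re-lined skeleton.  Supersedes ✓ `KbarRational.cleanModels_algClosed_dimLEThree`
(which also took `CP2008.ResolutionQuasiProjectiveThreefolds`). [cite: Posva2024, Claim 5.1.2 and App. A §A.7] -/
theorem cleanModels_algClosed_dimLEThree_of_cossartRational (hCR : Cossart1987ThmRational) :
    ∀ p : ℕ, p.Prime → ∀ (k : Type) [Field k] [CharP k p] (W : AlgebraicGeometry.Scheme.{0}) [AlgebraicGeometry.IsIntegral W]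
      (f : W ⟶ AlgebraicGeometry.Spec (.of k)) (L : Type) [Field L] [Algebra W.functionField L],
      AlgebraicGeometry.IsSeparated f → AlgebraicGeometry.LocallyOfFiniteType f → AlgebraicGeometry.QuasiCompact f →
      Literature.AlgebraicGeometry.Resolution.Scheme.IsRegular W → IsPurelyInseparable W.functionField L →
      Module.finrank W.functionField L = p → IsAlgClosed k → topologicalKrullDim W ≤ 3 →
      ∃ (V : AlgebraicGeometry.Scheme.{0}) (π : V ⟶ W) (_ : AlgebraicGeometry.IsIntegral V) (_ : AlgebraicGeometry.IsDominant π),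
        AlgebraicGeometry.IsProper π ∧ Literature.AlgebraicGeometry.Resolution.IsBirational π ∧
        Literature.AlgebraicGeometry.Resolution.Scheme.IsRegular V ∧
        (∀ v : V, (∃ (y : L) (g : W.functionField), y ∉ Set.range (algebraMap W.functionField L) ∧
          algebraMap W.functionField L g = y ^ p ∧
          ((∃ (d m : ℕ) (hmd : m ≤ d) (t : Fin d → V.presheaf.stalk v) (a : Fin m → ℕ),
              Ideal.span (Set.range t) = IsLocalRing.maximalIdeal (V.presheaf.stalk v) ∧
              ringKrullDim (V.presheaf.stalk v) = (d : WithBot ℕ∞) ∧ 0 < m ∧ (∀ i, ¬ p ∣ a i) ∧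
              Literature.AlgebraicGeometry.Motives.RatFn.functionFieldMap π g = ∏ i : Fin m,
                (algebraMap (V.presheaf.stalk v) V.functionField (t (Fin.castLE hmd i))) ^ (a i)) ∨
            (∃ u₀ : V.presheaf.stalk v, IsUnit u₀ ∧
              Literature.AlgebraicGeometry.Motives.RatFn.functionFieldMap π g =
                algebraMap (V.presheaf.stalk v) V.functionField u₀ ∧
              ((∀ c : V.presheaf.stalk v, u₀ - c ^ p ∉ IsLocalRing.maximalIdeal (V.presheaf.stalk v)) ∨
                (∃ c : V.presheaf.stalk v, u₀ - c ^ p ∈ IsLocalRing.maximalIdeal (V.presheaf.stalk v) ∧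
                  u₀ - c ^ p ∉ IsLocalRing.maximalIdeal (V.presheaf.stalk v) ^ 2)))))) := by
  intro p hp k _ _ W _ f L _ _ hs hl hq hr hpi hd halg h3
  haveI := hs; haveI := hl; haveI := hq; haveI := hpi; haveI := halg
  exact cleanModelsAt_dimLEThree_algClosed_of_cossartRational hCR p hp k W f hr h3 L hd

/-- **Cossart 1987 / Posva 2024 Claim 5.1.2 for EVERY regular threefold over `k̄` — the quasi-projectivity hypothesis of the typed named fact
`Cossart1987ThmRational` REMOVED in kernel** (appended, same seat).  For `X` integral, quasi-compact, separated and locally of finite type over an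
algebraically closed field `k` of characteristic `p`, regular of dimension `3` (NOT necessarily quasi-projective), and `u ∈ K(X) ∖ K(X)^p`: the
conclusion of `Cossart1987ThmRational` verbatim — a proper dominant `π : X' → X`, an isomorphism over a non-empty open, `X'` integral and regular,
and at every point of `X'` a germ `g = π^♯(u v^p)` (`v ≠ 0`) with Cossart's `ν = 0`.  Proof: `exists_quasiProjective_regular_model_dimThree` gives a
regular quasi-projective proper birational `σ : X₂ → X`; the named fact on `X₂` for `σ^♯ u`; compose and pull the multipliers `v` back along the
bijective `σ^♯`.  So every consumer of the named fact (the `k = k̄` LU node ✓ `KbarRational.cleanLU3_algClosed_of_cossartRational`, the global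
read-off ✓ `KbarRational.cleanModelsAt_quasiProjective_dimThree_algClosed_of_cossartRational`) may drop «quasi-projective».
[cite: Posva2024, Claim 5.1.2 and App. A §A.7] [cite: Cossart1987, main theorem] [cite: CossartPiltant2019, Prop. 4.4]
[cite: StacksProject, Tag 081T] -/
theorem cossartRational_of_isRegular (hCR : Cossart1987ThmRational)
    (p : ℕ) [Fact p.Prime] (k : Type) [Field k] [CharP k p] [IsAlgClosed k]
    (X : Scheme.{0}) [IsIntegral X] [CompactSpace X] (sX : X ⟶ Spec (CommRingCat.of k))
    [LocallyOfFiniteType sX] [IsSeparated sX]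
    (hX : Scheme.IsRegular X) (hdim : topologicalKrullDim X = 3)
    (u : X.functionField) (hu : ∀ c : X.functionField, c ^ p ≠ u) :
    ∃ (X' : Scheme.{0}) (π : X' ⟶ X) (_ : IsIntegral X') (_ : IsDominant π),
      IsProper π ∧ Scheme.IsRegular X' ∧ (∃ U : X.Opens, (U : Set X).Nonempty ∧ IsIso (π ∣_ U)) ∧
      ∀ x' : X', ∃ (v : X.functionField) (g : X'.presheaf.stalk x'), v ≠ 0 ∧
        algebraMap (X'.presheaf.stalk x') X'.functionField g = RatFn.functionFieldMap π (u * v ^ p) ∧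
        NuZeroAt g := by
  classical
  haveI : QuasiCompact sX := (HasAffineProperty.iff_of_isAffine (P := @QuasiCompact)).mpr ‹CompactSpace X›
  /- a regular quasi-projective proper birational model `σ : X₂ → X` -/
  obtain ⟨X₂, σ, hX₂int, hσprop, hbir₂, hX₂reg, hqp₂, hdim₂⟩ :=
    exists_quasiProjective_regular_model_dimThree k X sX hX hdim
  haveI := hX₂int
  haveI := hσprop
  haveI : IsDominant σ := hbir₂.isDominant
  let f₂ : X₂ ⟶ Spec (.of k) := σ ≫ sX
  obtain ⟨hlft₂, hsep₂, hqc₂⟩ := hqp₂.finiteType_isSeparated_quasiCompact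
  haveI := hlft₂; haveI := hsep₂; haveI := hqc₂
  haveI : CompactSpace X₂ := QuasiCompact.compactSpace_of_compactSpace f₂
  have hbij₂ : Function.Bijective (RatFn.functionFieldMap σ) := by
    obtain ⟨U', hU', hU'', hiso⟩ := hbir₂
    haveI := hiso
    exact RatFn.functionFieldMap_bijective_of_isIso_morphismRestrict σ U' hU' hU''
  let u₂ : X₂.functionField := RatFn.functionFieldMap σ u
  have hu₂ : ∀ c : X₂.functionField, c ^ p ≠ u₂ := by
    intro c hc
    obtain ⟨c', rfl⟩ := hbij₂.2 c
    exact hu c' (hbij₂.1 (by rw [map_pow]; exact hc))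
  /- the named fact on `X₂` -/
  obtain ⟨V, π₃, hVint, hdom₃, hπ₃, hVreg, ⟨U₂, hU₂ne, hiso₂⟩, hν⟩ := hCR p k X₂ f₂ hqp₂ hX₂reg hdim₂ u₂ hu₂
  haveI := hVint
  haveI := hdom₃
  haveI := hπ₃
  haveI := hiso₂
  obtain ⟨hbir₃, -⟩ := Lens5.KbarCossart.isBirational_and_denseRange π₃ U₂ hU₂ne
  /- the composite -/
  let π : V ⟶ X := π₃ ≫ σ
  have hbir : IsBirational π := hbir₃.comp hbir₂
  haveI hdom : IsDominant π := hbir.isDominant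
  have hcomp : ∀ z : X.functionField,
      RatFn.functionFieldMap π z = RatFn.functionFieldMap π₃ (RatFn.functionFieldMap σ z) := fun z =>
    RingHom.congr_fun (RatFn.functionFieldMap_comp σ π₃) z
  obtain ⟨U, hU, -, hisoU⟩ := id hbir
  refine ⟨V, π, hVint, hdom, inferInstance, hVreg, ⟨U, hU.nonempty, hisoU⟩, fun x' => ?_⟩
  obtain ⟨v₂, g, hv₂, hg, hN⟩ := hν x'
  obtain ⟨v, rfl⟩ := hbij₂.2 v₂
  refine ⟨v, g, fun h0 => hv₂ (by rw [h0, map_zero]), ?_, hN⟩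
  rw [hg, hcomp]
  simp only [map_mul, map_pow, u₂]

end Summit.ResolutionOfSingularities.ResolutionOfSingularities.Theorems.RadicialJung.CleanModels.KbarQuasiProjective

end
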